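import Summits.NavierStokesRegularity.NavierStokesRegularity.Theorems.SoloSalvageLindgren2012EnstrophySlice
import Literature.Analysis.FluidPDE.TaoLocalisationProofs
import Mathlib.MeasureTheory.Integral.IntervalIntegral.FundThmCalculus
import HarnessLib

/-!
# Solo salvage for claim C32 `Lindgren2012`, part 4c (cell `ns-claims`, D-0090): the enstrophy
# evolution (14)–(25) is TRUE in the rendered class — the pointwise-in-time enstrophy identity on `ℝ³`

Claim skeleton: `Literature/Claims/NS/Lindgren2012.lean` (J. Lindgren, arXiv:1207.1090 v3). Adjudicated
#93: first failing step `Step4_VanishingIntegral_kinematic` (26) p. 3 (kernel-false, p487600). This file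
(seat `ns-claims-salvage-p3` g3) discharges Step 3, which PRECEDES the locator:
`lindgren2012_step3_holds : Step3_EnstrophyEvolution` — along every solution of the class on `[0,T]`
(`ν, T > 0`; classical on the closed slab, all `L²` Sobolev norms bounded) the enstrophy `E(t) = ∫|ω(t)|²`
has at EVERY `t ∈ [0,T]` the derivative `2(∫ ω·((∇×ω)×u_⊥) + ν∫ ω·Δω)` within `[0,T]`, i.e.
`dE/dt = 2∫⟪ω,(∇u)ω⟫ − 2ν∫|∇ω|²` on `ℝ³` read in the paper's variables (21)–(25).

Proof (tree + parts 4a/4b): (A) the `ℓ²` balance of `ω = curl u` on the slab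
(`IsSmoothSpaceTimeOn.l2_balance`; `∂ₜω` is `L^∞_t L²_x` by the vorticity equation,
`lintegral_enorm_sq_le_of_vorticity_eq`); (B) the slice identity `integral_two_mul_inner_curl_eq`;
(C) continuity of `t ↦ 2(stretch + ν dissip)` on `[0,T]` — `L²`-continuity of `ω` in time
(`tendsto_integral_norm_sub_sq`), Cauchy–Schwarz, Green's second identity in the `H²` class
(`integral_inner_laplacian_symm`), dominated convergence for the bounded jointly continuous kernel `∇u`;
(D) the FTC within `[0,T]`. C32 row: Steps 1, 2, 3, 5, 6 KERNEL-TRUE (p484197, p485039, p493163, this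
file), Step 4 the locator. Mathematics: the enstrophy equation (Majda–Bertozzi 2002 §3.1). Solo lane.

WHAT THIS IS NOT: not a claim about NS regularity or blow-up; not a claim about any author beyond the
typed locator.
-/

noncomputable section

set_option linter.dupNamespace false
-- nested operator types (second derivatives of slices)
set_option maxSynthPendingDepth 3

open MeasureTheory Set Filter
open _root_.Topology
open scoped ENNReal NNReal ContDiff RealInnerProductSpace Laplacian

namespace Summit.NavierStokesRegularity.NavierStokesRegularity.Theorems.Lindgren2012Salvage

open Literature.Analysis.FluidPDE Literature.Claims.NS.Ruzmaikina2008 Literature.Claims.NS.Lindgren2012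

/-! ## §4 Step 3: the enstrophy evolution (14)–(25) holds in the class -/

set_option maxHeartbeats 1600000 in
/-- **Step 3 of C32 is TRUE** — (14)–(25), l.100–155 (print p. 2–3): along every solution of the class
on `[0,T]` (`ν, T > 0`), `E(t) = ∫|ω(t)|²` has at every `t ∈ [0,T]` the derivative
`2(∫ ω·((∇×ω)×u_⊥) + ν∫ ω·Δω)` within `[0,T]` (`Step3_EnstrophyEvolution`): the pointwise-in-time
enstrophy identity `dE/dt = 2∫⟪ω,(∇u)ω⟫ − 2ν∫|∇ω|²` on `ℝ³` in the Beale–Kato–Majda class, in the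
paper's variables ((21)–(23), (27)). Steps (A)–(D) of the module docstring.
[cite: Lindgren2012, (14)–(25) l.100–155 (print p. 2–3)] [cite: MajdaBertozziCUP2002, §3.1.1 p. 87–88] -/
theorem lindgren2012_step3_holds : Literature.Claims.NS.Lindgren2012.Step3_EnstrophyEvolution := by
  intro ν T u p hν hT hsol t ht
  have hS : IsClassicalNSSolutionOn (Icc 0 T) ν 0 u p := hsol.isClassical
  have hB : HasBoundedSobolevNormsOn (Icc 0 T) u := hsol.sobolev
  have hU : UniqueDiffOn ℝ (Icc 0 T) := uniqueDiffOn_Icc hT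
  set κ : ℝ := ‖curlCLM‖ with hκ
  -- smoothness of the slices
  have hsm : ∀ s ∈ Icc 0 T, ContDiff ℝ ∞ (u s) := fun s hs => hS.contDiff_velocity hs
  have hsm3 : ∀ s ∈ Icc 0 T, ContDiff ℝ 3 (u s) := fun s hs => (hsm s hs).of_le (by norm_cast)
  have hsm2 : ∀ s ∈ Icc 0 T, ContDiff ℝ 2 (u s) := fun s hs => (hsm s hs).of_le (by norm_cast)
  -- sup bounds on `u` and `∇u`
  obtain ⟨B₀, hB₀⟩ := linfty_bound_of_hasBoundedSobolevNormsOn_holds hsm2 hB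
  obtain ⟨B₁, hB₁0, hB₁⟩ := exists_forall_norm_fderiv_le_of_hasBoundedSobolevNormsOn hsm3 hB
  have h0S : (0 : ℝ) ∈ Icc 0 T := ⟨le_rfl, hT.le⟩
  have hB₀0 : 0 ≤ B₀ := (norm_nonneg _).trans (hB₀ 0 h0S 0)
  -- the Sobolev bounds
  have hfin : ∀ n, ∀ s ∈ Icc 0 T, ∫⁻ x, ‖iteratedFDeriv ℝ n (u s) x‖ₑ ^ 2 < ⊤ := fun n s hs => by
    obtain ⟨C, hC⟩ := hB n
    exact (hC s hs).trans_lt ENNReal.coe_lt_top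
  choose Cn hCn using hB
  -- the vorticity field and its (pressure-free) time derivative
  set vort : ℝ → EuclideanSpace ℝ (Fin 3) → EuclideanSpace ℝ (Fin 3) := vorticity u with hωdef
  have hωt : ∀ s, vort s = curl (u s) := fun s => rfl
  have hωsm : IsSmoothSpaceTimeOn (Icc 0 T) vort :=
    (hS.smooth_velocity.fderiv_slice hU).clm_comp curlCLM
  set W : ℝ → EuclideanSpace ℝ (Fin 3) → EuclideanSpace ℝ (Fin 3) :=
    timeDerivWithin (Icc 0 T) vort with hWdef
  have hWsm : IsSmoothSpaceTimeOn (Icc 0 T) W := hωsm.timeDerivWithin hU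
  have hvort : ∀ s ∈ Icc 0 T, ∀ x,
      W s x + convect (u s) (vort s) x = convect (vort s) (u s) x + ν • (Δ (vort s)) x := fun s hs x =>
    (hS.isVorticitySolutionOn_of_uniqueDiffOn hU (fun s _ y => curl_zero y)).vorticity_eq s hs x
  have hωc : ∀ s ∈ Icc 0 T, Continuous (vort s) := fun s hs => (hωsm.contDiff_slice hs).continuous
  -- `L²` bound for the vorticity
  set V₀ : ℝ≥0∞ := ENNReal.ofReal (κ ^ 2) * (Cn 1 : ℝ≥0∞) with hV₀
  have hV₀top : V₀ < ⊤ := ENNReal.mul_lt_top ENNReal.ofReal_lt_top ENNReal.coe_lt_top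
  have hωL2 : ∀ s ∈ Icc 0 T, ∫⁻ x, ‖vort s x‖ₑ ^ 2 ≤ V₀ := fun s hs =>
    (lintegral_curl_sq_le (u s)).trans (mul_le_mul' le_rfl (hCn 1 s hs))
  have hωfin : ∀ s ∈ Icc 0 T, ∫⁻ x, ‖vort s x‖ₑ ^ 2 < ⊤ := fun s hs => (hωL2 s hs).trans_lt hV₀top
  -- `L²` bound for the time derivative of the vorticity (orders `1, 2, 3`; pressure-free)
  set V₁ : ℝ≥0∞ := 3 * (ENNReal.ofReal ((ν * (3 * κ)) ^ 2) * (Cn 3 : ℝ≥0∞) +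
    ENNReal.ofReal ((B₀ * κ) ^ 2) * (Cn 2 : ℝ≥0∞) + ENNReal.ofReal ((B₁ * κ) ^ 2) * (Cn 1 : ℝ≥0∞))
    with hV₁
  have hV₁top : V₁ < ⊤ := by
    refine ENNReal.mul_lt_top (by norm_num) ?_
    refine ENNReal.add_lt_top.2 ⟨ENNReal.add_lt_top.2 ⟨?_, ?_⟩, ?_⟩ <;>
      exact ENNReal.mul_lt_top ENNReal.ofReal_lt_top ENNReal.coe_lt_top
  have hWL2 : ∀ s ∈ Icc 0 T, ∫⁻ x, ‖W s x‖ₑ ^ 2 ≤ V₁ := fun s hs =>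
    lintegral_enorm_sq_le_of_vorticity_eq hν.le (hsm3 s hs) hB₀0 (hB₀ s hs) hB₁0 (hB₁ s hs)
      (hvort s hs) (hCn 1 s hs) (hCn 2 s hs) (hCn 3 s hs)
  -- (A) the balance of the enstrophy
  obtain ⟨-, hYcont, hbal⟩ := hωsm.l2_balance hT (C₀ := V₀.toNNReal) (C₁ := V₁.toNNReal)
    (fun s hs => by rw [ENNReal.coe_toNNReal hV₀top.ne]; exact hωL2 s hs)
    (fun s hs => by rw [ENNReal.coe_toNNReal hV₁top.ne]; exact hWL2 s hs)
  -- (B) the slice identity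
  set Φ : ℝ → ℝ := fun s => 2 * (stretchPerp (u s) + ν * dissip (u s)) with hΦdef
  have hΦ : ∀ s ∈ Icc 0 T, (∫ x, 2 * ⟪vort s x, W s x⟫) = Φ s := fun s hs =>
    integral_two_mul_inner_curl_eq (hsm s hs) (hS.divFree s hs) (fun n => hfin n s hs) (hB₀ s hs)
      (hB₁ s hs) (hvort s hs)
  -- `L²`-continuity in time of the vorticity, and the real bound `Y ≤ V₀`
  have hD : ∀ s₀ ∈ Icc 0 T, Tendsto (fun s => ∫ x, ‖vort s x - vort s₀ x‖ ^ 2)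
      (𝓝[Icc 0 T] s₀) (𝓝 0) := fun s₀ hs₀ =>
    tendsto_integral_norm_sub_sq hT hωsm (C₀ := V₀.toNNReal) (C₁ := V₁.toNNReal)
      (fun s hs => by rw [ENNReal.coe_toNNReal hV₀top.ne]; exact hωL2 s hs)
      (fun s hs => by rw [ENNReal.coe_toNNReal hV₁top.ne]; exact hWL2 s hs) hs₀
  have hYle : ∀ s ∈ Icc 0 T, ∫ x, ‖vort s x‖ ^ 2 ≤ V₀.toReal := fun s hs =>
    integral_norm_sq_le_toReal (hωc s hs) hV₀top (hωL2 s hs)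
  have cDu : ContinuousOn (fun z : ℝ × EuclideanSpace ℝ (Fin 3) => fderiv ℝ (u z.1) z.2)
      (Icc 0 T ×ˢ univ) := hS.smooth_velocity.continuousOn_fderiv_slice hU
  have hDuc : ∀ s ∈ Icc 0 T, Continuous (fderiv ℝ (u s)) := fun s hs =>
    (hsm s hs).continuous_fderiv (by simp)
  -- (C₁) continuity of the stretching integral
  have hScont : ContinuousOn (fun s => stretch (u s)) (Icc 0 T) := by
    have hS' : ∀ s ∈ Icc 0 T, stretch (u s) = ∫ x, ⟪vort s x, fderiv ℝ (u s) x (vort s x)⟫ :=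
      fun s hs => (integral_stretching_eq_stretch (hsm s hs) (hS.divFree s hs) (hB₀ s hs) (hB₁ s hs)
        (hfin 1 s hs) (hfin 2 s hs)).symm
    have hI : ∀ s ∈ Icc 0 T, Integrable fun x => ⟪vort s x, fderiv ℝ (u s) x (vort s x)⟫ :=
      fun s hs => (abs_integral_inner_clm_le (hωc s hs) (hωc s hs) (hDuc s hs) (hωfin s hs)
        (hωfin s hs) hB₁0 (hB₁ s hs)).1
    intro s₀ hs₀
    set F₁ : ℝ → EuclideanSpace ℝ (Fin 3) → ℝ := fun s x =>
      ⟪vort s x - vort s₀ x, fderiv ℝ (u s) x (vort s x)⟫ with hF₁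
    set F₂ : ℝ → EuclideanSpace ℝ (Fin 3) → ℝ := fun s x =>
      ⟪vort s₀ x, fderiv ℝ (u s) x (vort s x - vort s₀ x)⟫ with hF₂
    set F₃ : ℝ → EuclideanSpace ℝ (Fin 3) → ℝ := fun s x =>
      ⟪vort s₀ x, (fderiv ℝ (u s) x - fderiv ℝ (u s₀) x) (vort s₀ x)⟫ with hF₃
    have hsplit : ∀ s x, ⟪vort s x, fderiv ℝ (u s) x (vort s x)⟫ -
        ⟪vort s₀ x, fderiv ℝ (u s₀) x (vort s₀ x)⟫ = F₁ s x + F₂ s x + F₃ s x := by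
      intro s x
      simp only [hF₁, hF₂, hF₃, inner_sub_left, inner_sub_right, map_sub, sub_apply]
      ring
    have hδc : ∀ s ∈ Icc 0 T, Continuous fun x => vort s x - vort s₀ x := fun s hs =>
      (hωc s hs).sub (hωc s₀ hs₀)
    have hδfin : ∀ s ∈ Icc 0 T, ∫⁻ x, ‖vort s x - vort s₀ x‖ₑ ^ 2 < ⊤ := fun s hs =>
      lintegral_enorm_sub_sq_lt_top (hωc s hs) (hωc s₀ hs₀) (hωfin s hs) (hωfin s₀ hs₀)
    have hF₁b : ∀ s ∈ Icc 0 T, Integrable (F₁ s) ∧ |∫ x, F₁ s x| ≤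
        B₁ * (Real.sqrt (∫ x, ‖vort s x - vort s₀ x‖ ^ 2) * Real.sqrt (∫ x, ‖vort s x‖ ^ 2)) :=
      fun s hs => abs_integral_inner_clm_le (hδc s hs) (hωc s hs) (hDuc s hs) (hδfin s hs) (hωfin s hs)
        hB₁0 (hB₁ s hs)
    have hF₂b : ∀ s ∈ Icc 0 T, Integrable (F₂ s) ∧ |∫ x, F₂ s x| ≤
        B₁ * (Real.sqrt (∫ x, ‖vort s₀ x‖ ^ 2) * Real.sqrt (∫ x, ‖vort s x - vort s₀ x‖ ^ 2)) :=
      fun s hs => abs_integral_inner_clm_le (hωc s₀ hs₀) (hδc s hs) (hDuc s hs) (hωfin s₀ hs₀)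
        (hδfin s hs) hB₁0 (hB₁ s hs)
    have hi0 : Integrable fun x => ‖vort s₀ x‖ ^ 2 :=
      integrable_sq_norm_of_lintegral_lt_top (hωc s₀ hs₀) (hωfin s₀ hs₀)
    have hF₃c : ∀ s ∈ Icc 0 T, Continuous (F₃ s) := fun s hs =>
      (hωc s₀ hs₀).inner (((hDuc s hs).sub (hDuc s₀ hs₀)).clm_apply (hωc s₀ hs₀))
    have hF₃le : ∀ s ∈ Icc 0 T, ∀ x, ‖F₃ s x‖ ≤ 2 * B₁ * ‖vort s₀ x‖ ^ 2 := by
      intro s hs x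
      rw [hF₃, Real.norm_eq_abs]
      calc |⟪vort s₀ x, (fderiv ℝ (u s) x - fderiv ℝ (u s₀) x) (vort s₀ x)⟫|
          ≤ ‖vort s₀ x‖ * ‖(fderiv ℝ (u s) x - fderiv ℝ (u s₀) x) (vort s₀ x)‖ :=
            abs_real_inner_le_norm _ _
        _ ≤ ‖vort s₀ x‖ * ((B₁ + B₁) * ‖vort s₀ x‖) := by
            gcongr
            refine (ContinuousLinearMap.le_opNorm _ _).trans (mul_le_mul_of_nonneg_right ?_ (norm_nonneg _))
            exact (norm_sub_le _ _).trans (add_le_add (hB₁ s hs x) (hB₁ s₀ hs₀ x))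
        _ = 2 * B₁ * ‖vort s₀ x‖ ^ 2 := by ring
    have hF₃i : ∀ s ∈ Icc 0 T, Integrable (F₃ s) := fun s hs =>
      (hi0.const_mul (2 * B₁)).mono' (hF₃c s hs).aestronglyMeasurable (Eventually.of_forall (hF₃le s hs))
    have hF₃ : Tendsto (fun s => ∫ x, F₃ s x) (𝓝[Icc 0 T] s₀) (𝓝 0) := by
      have h0 : (∫ x, F₃ s₀ x) = 0 := by simp [hF₃]
      have hlim : Tendsto (fun s => ∫ x, F₃ s x) (𝓝[Icc 0 T] s₀) (𝓝 (∫ x, F₃ s₀ x)) := by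
        refine tendsto_integral_filter_of_dominated_convergence (fun x => 2 * B₁ * ‖vort s₀ x‖ ^ 2)
          ?_ ?_ (hi0.const_mul _) ?_
        · exact eventually_nhdsWithin_of_forall fun s hs => (hF₃c s hs).aestronglyMeasurable
        · exact eventually_nhdsWithin_of_forall fun s hs => Eventually.of_forall (hF₃le s hs)
        · refine Eventually.of_forall fun x => ?_
          have hc : ContinuousOn (fun s => fderiv ℝ (u s) x) (Icc 0 T) :=
            cDu.comp (continuous_id.prodMk continuous_const).continuousOn fun s hs => ⟨hs, mem_univ _⟩
          have h3 : ContinuousOn (fun s => F₃ s x) (Icc 0 T) := by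
            simp only [hF₃]
            exact continuousOn_const.inner ((hc.sub continuousOn_const).clm_apply continuousOn_const)
          exact h3 s₀ hs₀
      rwa [h0] at hlim
    have hV0r : 0 ≤ Real.sqrt V₀.toReal := Real.sqrt_nonneg _
    have key : ∀ s ∈ Icc 0 T, ‖stretch (u s) - stretch (u s₀)‖ ≤
        2 * B₁ * Real.sqrt V₀.toReal * Real.sqrt (∫ x, ‖vort s x - vort s₀ x‖ ^ 2) +
          |∫ x, F₃ s x| := by
      intro s hs
      rw [Real.norm_eq_abs, hS' s hs, hS' s₀ hs₀, ← integral_sub (hI s hs) (hI s₀ hs₀),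
        integral_congr_ae (Eventually.of_forall (hsplit s)),
        integral_add (f := fun x => F₁ s x + F₂ s x) (g := F₃ s) ((hF₁b s hs).1.add (hF₂b s hs).1)
          (hF₃i s hs), integral_add (hF₁b s hs).1 (hF₂b s hs).1]
      have e1 := (hF₁b s hs).2
      have e2 := (hF₂b s hs).2
      have hY1 : Real.sqrt (∫ x, ‖vort s x‖ ^ 2) ≤ Real.sqrt V₀.toReal := Real.sqrt_le_sqrt (hYle s hs)
      have hY2 : Real.sqrt (∫ x, ‖vort s₀ x‖ ^ 2) ≤ Real.sqrt V₀.toReal :=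
        Real.sqrt_le_sqrt (hYle s₀ hs₀)
      have hDs0 : 0 ≤ Real.sqrt (∫ x, ‖vort s x - vort s₀ x‖ ^ 2) := Real.sqrt_nonneg _
      calc |(∫ x, F₁ s x) + (∫ x, F₂ s x) + ∫ x, F₃ s x|
          ≤ |∫ x, F₁ s x| + |∫ x, F₂ s x| + |∫ x, F₃ s x| := abs_add_three _ _ _
        _ ≤ B₁ * (Real.sqrt (∫ x, ‖vort s x - vort s₀ x‖ ^ 2) * Real.sqrt V₀.toReal) +
            B₁ * (Real.sqrt V₀.toReal * Real.sqrt (∫ x, ‖vort s x - vort s₀ x‖ ^ 2)) +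
            |∫ x, F₃ s x| := by
            gcongr
            · exact e1.trans (by gcongr)
            · exact e2.trans (by gcongr)
        _ = 2 * B₁ * Real.sqrt V₀.toReal * Real.sqrt (∫ x, ‖vort s x - vort s₀ x‖ ^ 2) +
            |∫ x, F₃ s x| := by ring
    have hg : Tendsto (fun s => 2 * B₁ * Real.sqrt V₀.toReal *
        Real.sqrt (∫ x, ‖vort s x - vort s₀ x‖ ^ 2) + |∫ x, F₃ s x|) (𝓝[Icc 0 T] s₀)
        (𝓝 (2 * B₁ * Real.sqrt V₀.toReal * Real.sqrt 0 + |(0 : ℝ)|)) :=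
      (((hD s₀ hs₀).sqrt).const_mul _).add hF₃.abs
    rw [Real.sqrt_zero, mul_zero, abs_zero, add_zero] at hg
    have hlim : Tendsto (fun s => stretch (u s) - stretch (u s₀)) (𝓝[Icc 0 T] s₀) (𝓝 0) :=
      squeeze_zero_norm' (eventually_nhdsWithin_of_forall key) hg
    exact tendsto_sub_nhds_zero_iff.1 hlim
  -- (C₂) continuity of the viscous pairing
  have hDcont : ContinuousOn (fun s => dissip (u s)) (Icc 0 T) := by
    have hΔc : ∀ s ∈ Icc 0 T, Continuous (Δ (vort s)) := fun s hs =>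
      continuous_laplacian (contDiff_curl (n := 2) (by exact hsm3 s hs))
    set V₂ : ℝ≥0∞ := 3 * (ENNReal.ofReal ((3 * κ) ^ 2) * (Cn 3 : ℝ≥0∞) +
      ENNReal.ofReal (0 ^ 2) * 0 + ENNReal.ofReal (0 ^ 2) * 0) with hV₂
    have hV₂top : V₂ < ⊤ := by
      refine ENNReal.mul_lt_top (by norm_num) ?_
      refine ENNReal.add_lt_top.2 ⟨ENNReal.add_lt_top.2 ⟨?_, by simp⟩, by simp⟩
      exact ENNReal.mul_lt_top ENNReal.ofReal_lt_top ENNReal.coe_lt_top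
    have hΔL2 : ∀ s ∈ Icc 0 T, ∫⁻ x, ‖(Δ (vort s)) x‖ₑ ^ 2 ≤ V₂ := by
      intro s hs
      have hv := hsm3 s hs
      have hw2 : ContDiff ℝ 2 (curl (u s)) := contDiff_curl (n := 2) (by exact hv)
      refine (lintegral_enorm_sq_le_of_norm_le_three (f := Δ (vort s))
        (g₂ := fun _ => (0 : EuclideanSpace ℝ (Fin 3))) (g₃ := fun _ => (0 : EuclideanSpace ℝ (Fin 3)))
        (a := 3 * κ) (b := 0) (c := 0)
        (hv.continuous_iteratedFDeriv le_rfl) continuous_const continuous_const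
        (by positivity) le_rfl le_rfl fun x => ?_).trans ?_
      · rw [zero_mul, add_zero, add_zero, hωt]
        calc ‖(Δ (curl (u s))) x‖ ≤ 3 * ‖iteratedFDeriv ℝ 2 (curl (u s)) x‖ :=
              norm_laplacian_le_three_mul_norm_iteratedFDeriv_two hw2 x
          _ ≤ 3 * (κ * ‖iteratedFDeriv ℝ 3 (u s) x‖) :=
              mul_le_mul_of_nonneg_left (norm_iteratedFDeriv_curl_le_opNorm_mul hv 2 (by norm_num) x)
                (by norm_num)
          _ = 3 * κ * ‖iteratedFDeriv ℝ 3 (u s) x‖ := by ring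
      · rw [hV₂]
        gcongr
        · exact hCn 3 s hs
        · simp
        · simp
    have hΔfin : ∀ s ∈ Icc 0 T, ∫⁻ x, ‖(Δ (vort s)) x‖ₑ ^ 2 < ⊤ := fun s hs =>
      (hΔL2 s hs).trans_lt hV₂top
    have hZle : ∀ s ∈ Icc 0 T, ∫ x, ‖(Δ (vort s)) x‖ ^ 2 ≤ V₂.toReal := fun s hs =>
      integral_norm_sq_le_toReal (hΔc s hs) hV₂top (hΔL2 s hs)
    have hωsmooth : ∀ s ∈ Icc 0 T, ContDiff ℝ ∞ (vort s) := fun s hs =>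
      contDiff_curl (n := (⊤ : ℕ∞)) (by exact_mod_cast hsm s hs)
    have hmem : ∀ s ∈ Icc 0 T, MemLp (vort s) 2 volume ∧
        (∀ i, MemLp (fun x => fderiv ℝ (vort s) x
          (stdOrthonormalBasis ℝ (EuclideanSpace ℝ (Fin 3)) i)) 2 volume) ∧
        (∀ i, MemLp (fun x => fderiv ℝ (fun y => fderiv ℝ (vort s) y
          (stdOrthonormalBasis ℝ (EuclideanSpace ℝ (Fin 3)) i)) x
          (stdOrthonormalBasis ℝ (EuclideanSpace ℝ (Fin 3)) i)) 2 volume) := fun s hs =>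
      memLp_curl_partials (hsm s hs) (hfin 1 s hs) (hfin 2 s hs) (hfin 3 s hs)
    intro s₀ hs₀
    obtain ⟨hm0, hm1, hm2⟩ := hmem s₀ hs₀
    -- the difference field `δ_s = ω_s − ω_{s₀} = curl (u_s − u_{s₀})`
    have hdsm : ∀ s ∈ Icc 0 T, ContDiff ℝ ∞ (u s - u s₀) := fun s hs => (hsm s hs).sub (hsm s₀ hs₀)
    have hdfin : ∀ s ∈ Icc 0 T, ∀ n : ℕ, ∫⁻ x, ‖iteratedFDeriv ℝ n (u s - u s₀) x‖ₑ ^ 2 < ⊤ := by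
      intro s hs n
      have hc : ∀ r ∈ Icc 0 T, Continuous (iteratedFDeriv ℝ n (u r)) := fun r hr =>
        (hsm r hr).continuous_iteratedFDeriv (by exact_mod_cast le_top)
      refine lt_of_le_of_lt (le_of_eq (lintegral_congr fun x => ?_))
        (lintegral_enorm_sub_sq_lt_top (hc s hs) (hc s₀ hs₀) (hfin n s hs) (hfin n s₀ hs₀))
      rw [iteratedFDeriv_sub_apply ((hsm s hs).of_le (by exact_mod_cast le_top)).contDiffAt
        ((hsm s₀ hs₀).of_le (by exact_mod_cast le_top)).contDiffAt]
    have hδ : ∀ s ∈ Icc 0 T, (vort s - vort s₀) = curl (u s - u s₀) := by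
      intro s hs
      funext x
      have h1 : DifferentiableAt ℝ (u s) x := (hsm s hs).differentiable (by simp) x
      have h2 : DifferentiableAt ℝ (u s₀) x := (hsm s₀ hs₀).differentiable (by simp) x
      rw [Pi.sub_apply, hωt, hωt]
      exact (curl_fun_sub h1 h2).symm
    -- the split `dissip(u s) − dissip(u s₀) = ∫⟪δ, Δω_s⟫ + ∫⟪ω₀, Δδ⟫`, and Green on the second term
    have hI : ∀ s ∈ Icc 0 T, Integrable fun x => ⟪vort s x, (Δ (vort s)) x⟫ := by
      intro s hs
      refine (abs_integral_le_of_norm_le_mul (f := vort s) (g := Δ (vort s)) ?_ (hωc s hs) (hΔc s hs)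
        (hωfin s hs) (hΔfin s hs) zero_le_one fun x => ?_).1
      · exact (hωc s hs).inner (hΔc s hs)
      · rw [one_mul]; exact abs_real_inner_le_norm _ _
    have key : ∀ s ∈ Icc 0 T, ‖dissip (u s) - dissip (u s₀)‖ ≤
        2 * Real.sqrt V₂.toReal * Real.sqrt (∫ x, ‖vort s x - vort s₀ x‖ ^ 2) := by
      intro s hs
      obtain ⟨hd0, hd1, hd2⟩ := memLp_curl_partials (hdsm s hs) (hdfin s hs 1) (hdfin s hs 2) (hdfin s hs 3)
      have hδsm : ContDiff ℝ ∞ (curl (u s - u s₀)) :=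
        contDiff_curl (n := (⊤ : ℕ∞)) (by exact_mod_cast hdsm s hs)
      have hδc : Continuous (curl (u s - u s₀)) := hδsm.continuous
      have hΔδc : Continuous (Δ (curl (u s - u s₀))) :=
        continuous_laplacian (hδsm.of_le (by norm_cast))
      -- pointwise identities
      have hδpt : ∀ x, curl (u s - u s₀) x = vort s x - vort s₀ x := fun x => by
        rw [← hδ s hs, Pi.sub_apply]
      have hΔδ : ∀ x, (Δ (curl (u s - u s₀))) x = (Δ (vort s)) x - (Δ (vort s₀)) x := fun x => by
        rw [← hδ s hs]
        exact ((hωsmooth s hs).of_le (by norm_cast)).contDiffAt.laplacian_sub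
          ((hωsmooth s₀ hs₀).of_le (by norm_cast)).contDiffAt
      have hδfin : ∫⁻ x, ‖curl (u s - u s₀) x‖ₑ ^ 2 < ⊤ := by
        refine lt_of_le_of_lt (le_of_eq (lintegral_congr fun x => by rw [hδpt x])) ?_
        exact lintegral_enorm_sub_sq_lt_top (hωc s hs) (hωc s₀ hs₀) (hωfin s hs) (hωfin s₀ hs₀)
      -- `G₁ = ⟪δ, Δω_s⟫`, `G₂ = ⟪ω₀, Δδ⟫`
      have hG₁ : Integrable (fun x => ⟪curl (u s - u s₀) x, (Δ (vort s)) x⟫) ∧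
          |∫ x, ⟪curl (u s - u s₀) x, (Δ (vort s)) x⟫| ≤ 1 * (Real.sqrt (∫ x, ‖curl (u s - u s₀) x‖ ^ 2) *
            Real.sqrt (∫ x, ‖(Δ (vort s)) x‖ ^ 2)) := by
        refine abs_integral_le_of_norm_le_mul ?_ hδc (hΔc s hs) hδfin (hΔfin s hs) zero_le_one
          fun x => ?_
        · exact hδc.inner (hΔc s hs)
        · rw [one_mul]; exact abs_real_inner_le_norm _ _
      have hΔδfin : ∫⁻ x, ‖(Δ (curl (u s - u s₀))) x‖ₑ ^ 2 < ⊤ := by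
        refine lt_of_le_of_lt (le_of_eq (lintegral_congr fun x => by rw [hΔδ x])) ?_
        exact lintegral_enorm_sub_sq_lt_top (hΔc s hs) (hΔc s₀ hs₀) (hΔfin s hs) (hΔfin s₀ hs₀)
      have hG₂i : Integrable fun x => ⟪vort s₀ x, (Δ (curl (u s - u s₀))) x⟫ := by
        refine (abs_integral_le_of_norm_le_mul ?_ (hωc s₀ hs₀) hΔδc (hωfin s₀ hs₀) hΔδfin zero_le_one
          fun x => ?_).1
        · exact (hωc s₀ hs₀).inner hΔδc
        · rw [one_mul]; exact abs_real_inner_le_norm _ _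
      -- Green: `∫⟪ω₀, Δδ⟫ = ∫⟪δ, Δω₀⟫`
      have hgreen : (∫ x, ⟪vort s₀ x, (Δ (curl (u s - u s₀))) x⟫) =
          ∫ x, ⟪curl (u s - u s₀) x, (Δ (vort s₀)) x⟫ :=
        integral_inner_laplacian_symm (hωsmooth s₀ hs₀) hδsm hm0 hm1 hm2 hd0 hd1 hd2
      have hG₂ : Integrable (fun x => ⟪curl (u s - u s₀) x, (Δ (vort s₀)) x⟫) ∧
          |∫ x, ⟪curl (u s - u s₀) x, (Δ (vort s₀)) x⟫| ≤ 1 * (Real.sqrt (∫ x, ‖curl (u s - u s₀) x‖ ^ 2) *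
            Real.sqrt (∫ x, ‖(Δ (vort s₀)) x‖ ^ 2)) := by
        refine abs_integral_le_of_norm_le_mul ?_ hδc (hΔc s₀ hs₀) hδfin (hΔfin s₀ hs₀) zero_le_one
          fun x => ?_
        · exact hδc.inner (hΔc s₀ hs₀)
        · rw [one_mul]; exact abs_real_inner_le_norm _ _
      -- the split
      have hsplit : ∀ x, ⟪vort s x, (Δ (vort s)) x⟫ - ⟪vort s₀ x, (Δ (vort s₀)) x⟫ =
          ⟪curl (u s - u s₀) x, (Δ (vort s)) x⟫ + ⟪vort s₀ x, (Δ (curl (u s - u s₀))) x⟫ := by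
        intro x
        rw [hδpt x, hΔδ x, inner_sub_left, inner_sub_right]
        ring
      have hDeq : (∫ x, ‖curl (u s - u s₀) x‖ ^ 2) = ∫ x, ‖vort s x - vort s₀ x‖ ^ 2 :=
        integral_congr_ae (Eventually.of_forall fun x => by simp only [hδpt x])
      have hZ1 : Real.sqrt (∫ x, ‖(Δ (vort s)) x‖ ^ 2) ≤ Real.sqrt V₂.toReal :=
        Real.sqrt_le_sqrt (hZle s hs)
      have hZ2 : Real.sqrt (∫ x, ‖(Δ (vort s₀)) x‖ ^ 2) ≤ Real.sqrt V₂.toReal :=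
        Real.sqrt_le_sqrt (hZle s₀ hs₀)
      have hDs0 : 0 ≤ Real.sqrt (∫ x, ‖vort s x - vort s₀ x‖ ^ 2) := Real.sqrt_nonneg _
      unfold dissip
      rw [Real.norm_eq_abs, ← hωt, ← hωt, ← integral_sub (hI s hs) (hI s₀ hs₀),
        integral_congr_ae (Eventually.of_forall hsplit), integral_add hG₁.1 hG₂i, hgreen]
      calc |(∫ x, ⟪curl (u s - u s₀) x, (Δ (vort s)) x⟫) + ∫ x, ⟪curl (u s - u s₀) x, (Δ (vort s₀)) x⟫|
          ≤ |∫ x, ⟪curl (u s - u s₀) x, (Δ (vort s)) x⟫| + |∫ x, ⟪curl (u s - u s₀) x, (Δ (vort s₀)) x⟫| :=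
            abs_add_le _ _
        _ ≤ 1 * (Real.sqrt (∫ x, ‖vort s x - vort s₀ x‖ ^ 2) * Real.sqrt V₂.toReal) +
            1 * (Real.sqrt (∫ x, ‖vort s x - vort s₀ x‖ ^ 2) * Real.sqrt V₂.toReal) := by
            rw [← hDeq]
            gcongr
            · exact hG₁.2.trans (by rw [hDeq]; gcongr)
            · exact hG₂.2.trans (by rw [hDeq]; gcongr)
        _ = 2 * Real.sqrt V₂.toReal * Real.sqrt (∫ x, ‖vort s x - vort s₀ x‖ ^ 2) := by ring
    have hg : Tendsto (fun s => 2 * Real.sqrt V₂.toReal * Real.sqrt (∫ x, ‖vort s x - vort s₀ x‖ ^ 2))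
        (𝓝[Icc 0 T] s₀) (𝓝 (2 * Real.sqrt V₂.toReal * Real.sqrt 0)) :=
      ((hD s₀ hs₀).sqrt).const_mul _
    rw [Real.sqrt_zero, mul_zero] at hg
    have hlim : Tendsto (fun s => dissip (u s) - dissip (u s₀)) (𝓝[Icc 0 T] s₀) (𝓝 0) :=
      squeeze_zero_norm' (eventually_nhdsWithin_of_forall key) hg
    exact tendsto_sub_nhds_zero_iff.1 hlim
  have hΦcont : ContinuousOn Φ (Icc 0 T) := by
    have h1 : ContinuousOn (fun s => 2 * (stretch (u s) + ν * dissip (u s))) (Icc 0 T) :=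
      continuousOn_const.mul (hScont.add (continuousOn_const.mul hDcont))
    refine h1.congr fun s _ => ?_
    simp only [hΦdef, stretchPerp_eq]
  -- (D) the fundamental theorem of calculus within `[0,T]`
  set P : ℝ → ℝ := fun r => (∫ x, ‖vort 0 x‖ ^ 2) + ∫ τ in (0 : ℝ)..r, Φ τ with hPdef
  have hPE : ∀ r ∈ Icc 0 T, enstrophy (u r) = P r := by
    intro r hr
    show (∫ x, ‖vort r x‖ ^ 2) = (∫ x, ‖vort 0 x‖ ^ 2) + ∫ τ in (0 : ℝ)..r, Φ τ
    rcases eq_or_lt_of_le hr.1 with h0 | hr0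
    · rw [← h0, intervalIntegral.integral_same, add_zero]
    · rw [hbal r ⟨hr0, hr.2⟩]
      congr 1
      refine intervalIntegral.integral_congr fun τ hτ => ?_
      rw [uIcc_of_le hr0.le] at hτ
      exact hΦ τ ⟨hτ.1, hτ.2.trans hr.2⟩
  have hP : HasDerivWithinAt P (Φ t) (Icc 0 T) t := by
    haveI : Fact (t ∈ Icc 0 T) := ⟨ht⟩
    have hint : IntervalIntegrable Φ volume 0 t :=
      (hΦcont.mono (Icc_subset_Icc_right ht.2)).intervalIntegrable_of_Icc ht.1
    exact (intervalIntegral.integral_hasDerivWithinAt_right hint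
      (hΦcont.stronglyMeasurableAtFilter_nhdsWithin measurableSet_Icc t) (hΦcont t ht)).const_add _
  exact hP.congr_of_mem (fun r hr => hPE r hr) ht

end Summit.NavierStokesRegularity.NavierStokesRegularity.Theorems.Lindgren2012Salvage

end
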